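import Mathlib
import HarnessLib
import Literature.MathematicalPhysics.QuantumLattice.SectorisedIncrementBoundGradedWeightedPrescribedPlateau
import Literature.MathematicalPhysics.QuantumLattice.SectorisedIncrementBoundBinomialWeightedPrescribedPlateau
import Summits.HubbardSuperconductivity.HubbardSuperconductivity.Theorems.KLProgrammeKLRegimeEngineTowerBlockStepLev

/-!
# Route `KLProgramme` — crux K3 ENGINE (stmt-HubbardSuperconductivity-20437 `KLRegimeEngineV17F2`), stub (b) v2, THE LEVELS PACKAGE (ℓ):
# instantiation (I1), MODEL HALF, WEIGHTED ALL-KNOWN TRACK — the two weighted + prescribed (Hstep) doors AT A BLOCK STEP, plateau and parent facts discharged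
# (E1-LEVELS-BLUEPRINT-g8 §1 / (I1); located item «(I2)-WT-ONCLASS», cure (α′), plan g22 (R165)/(R167); cell gate-hubbard-kl, seat hubbard-kl-k3c2-p3 g12 as
#  SUBSTITUTE typer while the E1 lineage is unseated — E1 may rename / supersede)

The common twin of `…EngineTowerBlockStepWt` (E1 g8: weighted, one pinned leg) and `…EngineTowerBlockStepLev` (E1 g8: prescribed output legs, no weight):
the WEIGHTED + PRESCRIBED doors `Literature/…/SectorisedIncrementBoundGradedWeightedPrescribedPlateau` (p625172, orders ≥ 2) and
`…BinomialWeightedPrescribedPlateau` (p625554, first order) at the block geometry `Γ = C^K_{(Λ_{J₂}, Λ_{J₁}]} = hubbardCovSliceCT L M β μ 0 K (klScale klE0 J₂)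
(klScale klE0 J₁)`, input family `F_{J₁−1} := klAnisoFamily … K klE0 (J₁−1)` with fat partner `F̃_{J₁−1} := bgmFatMultiplier … (J₁−1)`, output family `F_{J′}`
(`1 ≤ J₁ ≤ J₂`, `J₁ ≤ J′`).  The four plateau facts are E1's (`…BlockStepWt` §1: `sum_klAnisoFamily_eq_one_of_blockSliceCT_ne_zero`,
`sum_klAnisoFamily_pred_eq_one_of_klAnisoFamily_ne_zero`, `bgmFatMultiplier_mul_bgmMultiplier`, `klAnisoFamily_eq_zero_of_sum_eq_zero`), the child relation is
SUPPORT OVERLAP with `hvan` = `overlap_of_sectorAnalysis_mul_sectorSub_ne_zero` (`…BlockStepLev` §1) and the parents count `27` = `card_parentsLeg_klAniso_le`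
(`…NormsJumpResectorisationPrescribed`) — all BY NAME, nothing restated.  The tree weight is any `IsTreeWeight wt` with leg maps `πi` (input labels), `πo`
(output labels); the tower takes `wt := klScaleWt L M β j`, `πi = πo := latticeLegPos (2·(2M))`.

* §1 **`blockStep_ordersGe2_wtFull_le`** — orders ≥ 2 of the block step: for even `G` without constant part, output legs `J` prescribed to the fine labels
  `τ″`, leg `p ∉ J` pinned at `w″`, the WEIGHTED sum `Σ_{X″_p = w″, (X″_j).2 = τ″_j} wt(πoX″)·‖kernel (map E(F_{J′})) (effAction Γ G − e^{Δ_Γ}G) (m+1) X″‖`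
  is bounded by the graded-prescribed right side in the WEIGHTED PRESCRIBED input sizes `B m′ Fc` of `G` at `F_{J₁−1}`
  (`ε^{2m′−1}·Σ_{σ|_E = τ|_E} Σ_{x_q = y} wt(πi(x,σ))·‖W_{F_{J₁−1},σ}(G)(x)‖ ≤ B m′ (|E|−1)`), parents constant `27`, MODULO the named block constants
  (Gram `κ`, WEIGHTED rows/cols `α` of `S(F̃)ᵀΓS(F̃)`, WEIGHTED overlap `(cr, cc)` of `E(F_{J′})·S(F̃)`, radius `ρ`, `θ < 1`);
* §2 **`blockStep_firstOrder_wtFull_le`** — first order `e^{Δ_Γ}G − G` likewise (binomial-prescribed right side; no `α, ρ, θ`).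
With `G := klTowerInput … d k` (`J₁ = dk`, `J₂ = d(k+1)`) these are the `hstep` suppliers of the weighted all-known born array `klTowerBornWtFull`
(`…EngineTowerModelDefsWtFull`, p624466) — the composition with the tower's increments is `…EngineTowerBlockIncrWtFull`.
Compositions of landed theorems; nothing about the model is asserted beyond them; nothing asserts (ℓ), any stub, K3 or superconductivity.
References: BGM 2006 (2.61)–(2.63), (2.66), §2.7 (2.70)–(2.71a), §2.8 (2.76)–(2.84), (2.88)–(2.90), App. A3 Lemma A3.1, §3 (3.2)–(3.8) [cite: BenfattoGiulianiMastropietro2006].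
-/

noncomputable section

namespace Summit.HubbardSuperconductivity.HubbardSuperconductivity.Theorems.EngineV8

set_option linter.dupNamespace false -- summit = problem name (single-conjunct summit), D-0017

open Real Finset Literature.MathematicalPhysics.QuantumLattice Literature.Probability.LatticeModels GrassmannAlgebra
open Summit.HubbardSuperconductivity.HubbardSuperconductivity.Theorems.KLProgrammeLegKernels
open Summit.HubbardSuperconductivity.HubbardSuperconductivity.Theorems.KLRegimeSplit
open Summit.HubbardSuperconductivity.HubbardSuperconductivity.Theorems.KLRegimeWick
open Summit.HubbardSuperconductivity.HubbardSuperconductivity.Theorems.TwoPointAssembly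
open Literature.Probability.LatticeModels.BattleFederbush

variable {L M : ℕ} [NeZero L] [NeZero M] {Λ : Type*} [DecidableEq Λ] {wt : Finset Λ → ℝ}

/-! ## §1 Orders ≥ 2 of a block step, weighted all-known track -/

/-- **ORDERS ≥ 2 OF A BLOCK STEP, WEIGHTED PINNED SUMS WITH PRESCRIBED OUTPUT LEGS (the graded weighted-prescribed door at the block geometry).**
`1 ≤ J₁ ≤ J₂`, `J₁ ≤ J′`; `F := F_{J₁−1}`, `F̃ := F̃_{J₁−1}`, `F′ := F_{J′}`, `Γ := C^K_{(Λ_{J₂}, Λ_{J₁}]}`; child relation = support overlap of `F′` with `F̃`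
(parents count `27`); `G` even without constant part; tree weight `wt` with leg maps `πi, πo`; block constants as hypotheses (`κ`, weighted `α`, weighted
`(cr, cc)`, `ρ`, `θ < 1`); WEIGHTED PRESCRIBED input sizes `B m′ Fc` of `G` at `F`; output legs `J` prescribed to `τ″`, pinned leg `p ∉ J`.  Conclusion: the
weighted sum over the so-constrained output tuples of `‖kernel (map E(F′)) (effAction Γ G − e^{Δ_Γ} G) (m+1) ·‖` is bounded by the door's graded-prescribed right side. -/
theorem blockStep_ordersGe2_wtFull_le (hwt : IsTreeWeight wt) {β : ℝ} (hβ : 0 < β) (μ : ℝ) (K : TrigPolyC4v) {J₁ J₂ J' : ℕ}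
    (hJ₁ : 1 ≤ J₁) (hJ : J₁ ≤ J₂) (hJ' : J₁ ≤ J')
    (πi : SpaceTimeIdx L M × SectorLeg (sectorCount (J₁ - 1)) → Λ) (πo : SpaceTimeIdx L M × SectorLeg (sectorCount J') → Λ)
    (G : HubbardGrassmann L M) (hG : G ∈ evenPart ℂ (HubbardFieldIdx L M)) (hG0 : constPart ℂ G = 0)
    {κ : ℝ} (hκ : 0 < κ)
    (hGB : IsGramBoundedR ((sectorSubMatrix L M β (bgmFatMultiplier L M klE0 β (nambuXiCT L μ K) (J₁ - 1))).transpose *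
      hubbardCovSliceCT L M β μ 0 K (klScale klE0 J₂) (klScale klE0 J₁) *
        sectorSubMatrix L M β (bgmFatMultiplier L M klE0 β (nambuXiCT L μ K) (J₁ - 1))) κ)
    (B : ℕ → ℕ → ℝ) (hB0 : ∀ m' Fc, 0 ≤ B m' Fc)
    (hB : ∀ (m' Fc : ℕ) (E : Finset (Fin (2 * m' + 1 + 1))) (τ : Fin (2 * m' + 1 + 1) → SectorLeg (sectorCount (J₁ - 1)))
      (q : Fin (2 * m' + 1 + 1)), q ∈ E → E.card = Fc + 1 → ∀ y : SpaceTimeIdx L M,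
        imagTimeWeight β M ^ (2 * m' + 1) *
          ∑ σ ∈ univ.filter (fun σ : Fin (2 * m' + 1 + 1) → SectorLeg (sectorCount (J₁ - 1)) => ∀ e ∈ E, σ e = τ e),
            ∑ x ∈ univ.filter (fun x : Fin (2 * m' + 1 + 1) → SpaceTimeIdx L M => x q = y),
              wt ((univ.image fun i => (x i, σ i)).image πi) *
                ‖sectorisedKernel L M β (klAnisoFamily L M β μ K klE0 (J₁ - 1)) G (2 * m' + 1 + 1) σ x‖ ≤ B (m' + 1) Fc)
    {α : ℝ} (hα : 0 < α)
    (hrow : ∀ X, ∑ Y, ‖((sectorSubMatrix L M β (bgmFatMultiplier L M klE0 β (nambuXiCT L μ K) (J₁ - 1))).transpose *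
        hubbardCovSliceCT L M β μ 0 K (klScale klE0 J₂) (klScale klE0 J₁) *
          sectorSubMatrix L M β (bgmFatMultiplier L M klE0 β (nambuXiCT L μ K) (J₁ - 1))) X Y‖ * wt {πi X, πi Y} ≤ α)
    (hcol : ∀ Y, ∑ X, ‖((sectorSubMatrix L M β (bgmFatMultiplier L M klE0 β (nambuXiCT L μ K) (J₁ - 1))).transpose *
        hubbardCovSliceCT L M β μ 0 K (klScale klE0 J₂) (klScale klE0 J₁) *
          sectorSubMatrix L M β (bgmFatMultiplier L M klE0 β (nambuXiCT L μ K) (J₁ - 1))) X Y‖ * wt {πi X, πi Y} ≤ α)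
    {ρ : ℝ} (hρ : 0 < ρ)
    (hθ : Real.exp 1 * α * normV (SpaceTimeIdx L M × SectorLeg (sectorCount (J₁ - 1))) κ ρ
      (fun m' => (27 : ℝ) ^ 0 * (imagTimeWeight β M * B m' 0)) / κ ^ 2 < 1)
    {cr cc : ℝ} (hcc0 : 0 ≤ cc)
    (hrow' : ∀ X'', ∑ X', ‖(sectorAnalysisMatrix L M β (klAnisoFamily L M β μ K klE0 J') *
        sectorSubMatrix L M β (bgmFatMultiplier L M klE0 β (nambuXiCT L μ K) (J₁ - 1))) X'' X'‖ * wt {πo X'', πi X'} ≤ cr)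
    (hcol' : ∀ X', ∑ X'', ‖(sectorAnalysisMatrix L M β (klAnisoFamily L M β μ K klE0 J') *
        sectorSubMatrix L M β (bgmFatMultiplier L M klE0 β (nambuXiCT L μ K) (J₁ - 1))) X'' X'‖ * wt {πo X'', πi X'} ≤ cc)
    {N₀ : ℕ} (hN₀ : 2 ≤ N₀) {m : ℕ} (p : Fin (m + 1)) (J : Finset (Fin (m + 1))) (hp : p ∉ J)
    (τ'' : Fin (m + 1) → SectorLeg (sectorCount J')) (w'' : SpaceTimeIdx L M × SectorLeg (sectorCount J')) :
    ∑ X'' ∈ univ.filter (fun X'' : Fin (m + 1) → SpaceTimeIdx L M × SectorLeg (sectorCount J') => X'' p = w'' ∧ ∀ j ∈ J, (X'' j).2 = τ'' j),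
        wt ((univ.image X'').image πo) *
          ‖kernel ℂ (ExteriorAlgebra.map (Matrix.toLin' (sectorAnalysisMatrix L M β (klAnisoFamily L M β μ K klE0 J')))
            (effAction ℂ (hubbardCovSliceCT L M β μ 0 K (klScale klE0 J₂) (klScale klE0 J₁)) G -
              gaussConv ℂ (hubbardCovSliceCT L M β μ 0 K (klScale klE0 J₂) (klScale klE0 J₁)) G)) (m + 1) X''‖ ≤
      cr * cc ^ m *
        (∑ n ∈ Ico 2 N₀, (κ⁻¹ ^ (m + 1) * κ⁻¹ ^ (2 * (n - 1)) * (α ^ (n - 1) * Real.exp n)) *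
            ∑ δ ∈ (Fintype.piFinset fun _ : Fin n => range (Fintype.card (SpaceTimeIdx L M × SectorLeg (sectorCount (J₁ - 1))) / 2 + 1)) with
                m + 1 + 2 * (n - 1) ≤ ∑ a, 2 * δ a,
              ∑ pf : J → Fin n, ((∏ j, ((2 * δ (pf j) : ℕ) : ℝ)) / ((∑ a, 2 * δ a : ℕ) : ℝ) ^ J.card) *
                ∏ a, (Real.exp 3 * κ) ^ (2 * δ a) *
                  ((27 : ℝ) ^ (univ.filter fun j : J => pf j = a).card *
                    (imagTimeWeight β M * B (δ a) (univ.filter fun j : J => pf j = a).card)) +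
          ρ⁻¹ ^ (m + 1) * (Real.exp 1 * normV (SpaceTimeIdx L M × SectorLeg (sectorCount (J₁ - 1))) κ ρ
              (fun m' => (27 : ℝ) ^ 0 * (imagTimeWeight β M * B m' 0))) *
            (Real.exp 1 * α * normV (SpaceTimeIdx L M × SectorLeg (sectorCount (J₁ - 1))) κ ρ
                (fun m' => (27 : ℝ) ^ 0 * (imagTimeWeight β M * B m' 0)) / κ ^ 2) ^ (N₀ - 1) /
            (1 - Real.exp 1 * α * normV (SpaceTimeIdx L M × SectorLeg (sectorCount (J₁ - 1))) κ ρ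
                (fun m' => (27 : ℝ) ^ 0 * (imagTimeWeight β M * B m' 0)) / κ ^ 2)) := by
  classical
  have he : (0 : ℝ) < klE0 := by norm_num [klE0]
  have hkJ : J₁ - 1 ≤ J' := by omega
  exact sum_filter_wt_norm_sectorAnalysis_effAction_sub_gaussConv_le_graded_prescribed_of_plateau hwt πi πo hβ
    (klAnisoFamily L M β μ K klE0 (J₁ - 1)) (bgmFatMultiplier L M klE0 β (nambuXiCT L μ K) (J₁ - 1))
    (fun ω k => bgmFatMultiplier_mul_bgmMultiplier he β (nambuXiCT L μ K) (J₁ - 1) ω k)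
    (fun k hk ω => klAnisoFamily_eq_zero_of_sum_eq_zero β μ K klE0 (J₁ - 1) k hk ω)
    (klAnisoFamily L M β μ K klE0 J') G hG hG0 _
    (fun X Y hXY => sum_klAnisoFamily_eq_one_of_blockSliceCT_ne_zero β μ K hJ₁ hJ X Y hXY)
    (fun ω' k hne => sum_klAnisoFamily_pred_eq_one_of_klAnisoFamily_ne_zero β μ K hJ₁ hJ' ω' k hne)
    (fun ω'' ω' => ∃ q : FreqMomentum L M, klAnisoFamily L M β μ K klE0 J' ω'' q ≠ 0 ∧
      bgmFatMultiplier L M klE0 β (nambuXiCT L μ K) (J₁ - 1) ω' q ≠ 0)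
    (fun X'' X' hne => overlap_of_sectorAnalysis_mul_sectorSub_ne_zero β _ _ X'' X' hne)
    (by norm_num) (fun ℓ'' => by convert card_parentsLeg_klAniso_le β μ K hkJ ℓ'' using 3)
    hκ hGB B hB0 hB hα hrow hcol hρ hθ hcc0 hrow' hcol' hN₀ p J hp τ'' w''

/-! ## §2 First order of a block step, weighted all-known track -/

/-- **FIRST ORDER OF A BLOCK STEP, WEIGHTED PINNED SUMS WITH PRESCRIBED OUTPUT LEGS (the binomial weighted-prescribed door at the block geometry).**
Same geometry, child relation and parents count; even `G`; tree weight `wt`; degree `2(q+1)` output with legs `J` prescribed to `τ″`, pinned leg `i ∉ J`;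
WEIGHTED PRESCRIBED input sizes `B m′ Fc`; weighted overlap `(cr, cc)`; Gram constant `κ ≥ 0`. -/
theorem blockStep_firstOrder_wtFull_le (hwt : IsTreeWeight wt) {β : ℝ} (hβ : 0 < β) (μ : ℝ) (K : TrigPolyC4v) {J₁ J₂ J' : ℕ}
    (hJ₁ : 1 ≤ J₁) (hJ : J₁ ≤ J₂) (hJ' : J₁ ≤ J')
    (πi : SpaceTimeIdx L M × SectorLeg (sectorCount (J₁ - 1)) → Λ) (πo : SpaceTimeIdx L M × SectorLeg (sectorCount J') → Λ)
    (G : HubbardGrassmann L M) (hG : G ∈ evenPart ℂ (HubbardFieldIdx L M))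
    {κ : ℝ} (hκ : 0 ≤ κ)
    (hGB : IsGramBoundedR ((sectorSubMatrix L M β (bgmFatMultiplier L M klE0 β (nambuXiCT L μ K) (J₁ - 1))).transpose *
      hubbardCovSliceCT L M β μ 0 K (klScale klE0 J₂) (klScale klE0 J₁) *
        sectorSubMatrix L M β (bgmFatMultiplier L M klE0 β (nambuXiCT L μ K) (J₁ - 1))) κ)
    (B : ℕ → ℕ → ℝ) (hB0 : ∀ m' Fc, 0 ≤ B m' Fc)
    (hB : ∀ (m' Fc : ℕ) (E : Finset (Fin (2 * m' + 1 + 1))) (τ : Fin (2 * m' + 1 + 1) → SectorLeg (sectorCount (J₁ - 1)))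
      (q : Fin (2 * m' + 1 + 1)), q ∈ E → E.card = Fc + 1 → ∀ y : SpaceTimeIdx L M,
        imagTimeWeight β M ^ (2 * m' + 1) *
          ∑ σ ∈ univ.filter (fun σ : Fin (2 * m' + 1 + 1) → SectorLeg (sectorCount (J₁ - 1)) => ∀ e ∈ E, σ e = τ e),
            ∑ x ∈ univ.filter (fun x : Fin (2 * m' + 1 + 1) → SpaceTimeIdx L M => x q = y),
              wt ((univ.image fun i => (x i, σ i)).image πi) *
                ‖sectorisedKernel L M β (klAnisoFamily L M β μ K klE0 (J₁ - 1)) G (2 * m' + 1 + 1) σ x‖ ≤ B (m' + 1) Fc)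
    {cr cc : ℝ} (hcc0 : 0 ≤ cc)
    (hrow' : ∀ X'', ∑ X', ‖(sectorAnalysisMatrix L M β (klAnisoFamily L M β μ K klE0 J') *
        sectorSubMatrix L M β (bgmFatMultiplier L M klE0 β (nambuXiCT L μ K) (J₁ - 1))) X'' X'‖ * wt {πo X'', πi X'} ≤ cr)
    (hcol' : ∀ X', ∑ X'', ‖(sectorAnalysisMatrix L M β (klAnisoFamily L M β μ K klE0 J') *
        sectorSubMatrix L M β (bgmFatMultiplier L M klE0 β (nambuXiCT L μ K) (J₁ - 1))) X'' X'‖ * wt {πo X'', πi X'} ≤ cc)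
    {q : ℕ} (i : Fin (2 * q + 1 + 1)) (J : Finset (Fin (2 * q + 1 + 1))) (hi : i ∉ J)
    (τ'' : Fin (2 * q + 1 + 1) → SectorLeg (sectorCount J')) (w'' : SpaceTimeIdx L M × SectorLeg (sectorCount J')) :
    ∑ X'' ∈ univ.filter (fun X'' : Fin (2 * q + 1 + 1) → SpaceTimeIdx L M × SectorLeg (sectorCount J') =>
        X'' i = w'' ∧ ∀ j ∈ J, (X'' j).2 = τ'' j),
        wt ((univ.image X'').image πo) *
          ‖kernel ℂ (ExteriorAlgebra.map (Matrix.toLin' (sectorAnalysisMatrix L M β (klAnisoFamily L M β μ K klE0 J')))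
            (gaussConv ℂ (hubbardCovSliceCT L M β μ 0 K (klScale klE0 J₂) (klScale klE0 J₁)) G - G)) (2 * q + 1 + 1) X''‖ ≤
      cr * cc ^ (2 * q + 1) *
        ∑ m' ∈ range (Fintype.card (SpaceTimeIdx L M × SectorLeg (sectorCount (J₁ - 1))) / 2 + 1), (if q + 1 < m' then
          ((((2 * (q + 1)).factorial : ℝ))⁻¹ * ((∏ j ∈ univ.filter (fun j : Fin (2 * (q + 1)) => j ∉ J), (2 * m' - (j : ℕ)) : ℕ) : ℝ)) *
            ((2 * m' : ℕ) : ℝ) ^ J.card * κ ^ (2 * m' - 2 * (q + 1)) *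
              ((27 : ℝ) ^ J.card * (imagTimeWeight β M * B m' J.card)) else 0) := by
  classical
  have he : (0 : ℝ) < klE0 := by norm_num [klE0]
  have hkJ : J₁ - 1 ≤ J' := by omega
  exact sum_filter_wt_norm_sectorAnalysis_gaussConv_sub_le_binomial_prescribed_of_plateau hwt πi πo hβ
    (klAnisoFamily L M β μ K klE0 (J₁ - 1)) (bgmFatMultiplier L M klE0 β (nambuXiCT L μ K) (J₁ - 1))
    (fun ω k => bgmFatMultiplier_mul_bgmMultiplier he β (nambuXiCT L μ K) (J₁ - 1) ω k)
    (fun k hk ω => klAnisoFamily_eq_zero_of_sum_eq_zero β μ K klE0 (J₁ - 1) k hk ω)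
    (klAnisoFamily L M β μ K klE0 J') G hG _
    (fun X Y hXY => sum_klAnisoFamily_eq_one_of_blockSliceCT_ne_zero β μ K hJ₁ hJ X Y hXY)
    (fun ω' k hne => sum_klAnisoFamily_pred_eq_one_of_klAnisoFamily_ne_zero β μ K hJ₁ hJ' ω' k hne)
    (fun ω'' ω' => ∃ q : FreqMomentum L M, klAnisoFamily L M β μ K klE0 J' ω'' q ≠ 0 ∧
      bgmFatMultiplier L M klE0 β (nambuXiCT L μ K) (J₁ - 1) ω' q ≠ 0)
    (fun X'' X' hne => overlap_of_sectorAnalysis_mul_sectorSub_ne_zero β _ _ X'' X' hne)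
    (by norm_num) (fun ℓ'' => by convert card_parentsLeg_klAniso_le β μ K hkJ ℓ'' using 3)
    hκ hGB B hB0 hB hcc0 hrow' hcol' i J hi τ'' w''

end Summit.HubbardSuperconductivity.HubbardSuperconductivity.Theorems.EngineV8

end
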